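import Literature.AnabelianGeometry.EtaleTheta.Discharge.Sec1DeltaYuuEllZHat
import HarnessLib

/-!
# `Ẑ`: a finite-index subgroup is determined by its index, hence CHARACTERISTIC (helper toward GAP G-w4d018-1)

[EtTh] §1 p. 13 («`(Δ^tp_Y)^ell ≅ Ẑ(1)`») and §2 p. 41 («`Y̲̲ → Y` of degree `l`»): the subcovering subgroup
`(Δ^tp_{Y̲̲})^ell ⊆ (Δ^tp_Y)^ell ≅ Ẑ` has finite index [cite: MochizukiEtTh2009, Def 2.7 p.41]; classical profinite
group theory: `Ẑ` has a UNIQUE (open) subgroup of each finite index [cite: RibesZalesskii2010, Thm 2.7.1].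

Cell abc-iut, seat abc-iut-w4-d018 (gen 6), PROOF-ONLY helper (0 `def`) toward the residual **G-w4d018-1** of row
«G-w4d043-2 FLSYMMETRY-GENUINE»: the conjugation action of `Π^tp_C` on `Δ^ell_Y(M) = (Δ^tp_{Y̲̲})^ell` ([IUTchII]
Rmk. 1.1.1 (iv)) must carry the finite-index subgroup `(Δ^tp_{Y̲̲})^ell` of `(Δ^tp_Y)^ell ≅ Ẑ` to itself although
`Π^tp_X̲̲` is not normal in `Π^tp_C` — and it does, because EVERY automorphism of a group isomorphic to `Ẑ` fixes
every finite-index subgroup: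

* `ZHatLevels.eq_of_index_eq` — two subgroups of `Ẑ` of the same nonzero index are EQUAL (both equal the open
  subgroup of that index: they contain the `n`-th powers, abc-iut-w5-d024's argument in
  `nonempty_mulEquiv_of_finiteIndex`, and abc-iut-L4-t6's `eq_closureZpowersPow_of_isOpen_of_index`);
* `ZHatLevels.map_mulEquiv_eq_of_index_ne_zero` — finite-index subgroups of `Ẑ` are fixed by every `Ẑ ≃* Ẑ`;
* `ZHatLevels.map_mulEquiv_eq_of_mulEquiv_zHat` — the same for any group `A ≃* Ẑ` (e.g. `(Δ^tp_Y)^ell`,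
  abc-iut-w5-d006's `IsEtThOrigin.nonempty_dtpYEll_mulEquiv_zHat`) and every `A ≃* A`.

HONEST FRAMING: classical group theory about the cell's `Ẑ`; nothing of [EtTh]/[IUTchII] asserted; outside the
[IUTchIII] Cor. 3.12 cone; no side taken.
-/

noncomputable section

namespace Literature.AnabelianGeometry.EtaleTheta

open Literature.AnabelianGeometry.AbsoluteAnabelian
open _root_.Topology
open CategoryTheory ProfiniteGrp ProfiniteGrp.ProfiniteCompletion

namespace ZHatLevels

/-- A subgroup of `Ẑ` of nonzero index `n` CONTAINS the open subgroup of index `n` (it contains all `n`-th powers,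
whose closure is that open subgroup). [cite: RibesZalesskii2010, Thm 2.7.1] -/
theorem openOfIndex_le (H U : Subgroup (completion (GrpCat.of (Multiplicative ℤ))))
    (hn : 0 < H.index) (hUopen : IsOpen (U : Set (completion (GrpCat.of (Multiplicative ℤ)))))
    (hUidx : U.index = H.index) : U ≤ H := by
  obtain ⟨g, hg⟩ := isFreeProcyclic_zHatCompletion.exists_dense_zpowers
  haveI : H.Normal := ⟨fun h hh x => by
    rwa [mul_comm_of_dense_zpowers hg x h, mul_inv_cancel_right]⟩
  have hU := eq_closureZpowersPow_of_isOpen_of_index hg hUopen hn hUidx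
  have hpow_closed : IsClosed (Set.range fun x : completion (GrpCat.of (Multiplicative ℤ)) => x ^ H.index) :=
    (isCompact_range (continuous_pow H.index)).isClosed
  have hpow_le : Set.range (fun x : completion (GrpCat.of (Multiplicative ℤ)) => x ^ H.index) ⊆ (H : Set _) := by
    rintro _ ⟨x, rfl⟩
    exact H.pow_index_mem x
  rw [hU]
  intro x hx
  have hx' : x ∈ closure ((Subgroup.zpowers (g ^ H.index) : Subgroup _) : Set _) := by
    rw [← Subgroup.topologicalClosure_coe]; exact hx
  refine hpow_le (closure_minimal ?_ hpow_closed hx')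
  rintro _ ⟨k, rfl⟩
  refine ⟨g ^ k, ?_⟩
  dsimp only
  rw [← zpow_natCast, ← zpow_mul, ← zpow_natCast, ← zpow_mul, mul_comm]

/-- **A finite-index subgroup of `Ẑ` IS the open subgroup of its index.** [cite: RibesZalesskii2010, Thm 2.7.1] -/
theorem eq_openOfIndex (H U : Subgroup (completion (GrpCat.of (Multiplicative ℤ))))
    (hn : 0 < H.index) (hUopen : IsOpen (U : Set (completion (GrpCat.of (Multiplicative ℤ)))))
    (hUidx : U.index = H.index) : H = U := by
  have hUH : U ≤ H := openOfIndex_le H U hn hUopen hUidx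
  refine le_antisymm ?_ hUH
  have h := Subgroup.relIndex_mul_index hUH
  rw [hUidx] at h
  have h1 : U.relIndex H = 1 := by
    have hne : H.index ≠ 0 := hn.ne'
    calc U.relIndex H = U.relIndex H * H.index / H.index := by rw [Nat.mul_div_cancel _ hn]
      _ = H.index / H.index := by rw [h]
      _ = 1 := Nat.div_self hn
  exact Subgroup.relIndex_eq_one.mp h1

/-- **Two subgroups of `Ẑ` with the same nonzero index are equal** (`Ẑ` has a unique subgroup of each finite
index). [cite: RibesZalesskii2010, Thm 2.7.1] -/
theorem eq_of_index_eq (H K : Subgroup (completion (GrpCat.of (Multiplicative ℤ)))) (hn : 0 < H.index)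
    (hHK : H.index = K.index) : H = K := by
  obtain ⟨U, hUopen, hUidx⟩ := ZHatCompletion.exists_isOpen_index hn
  rw [eq_openOfIndex H U hn hUopen hUidx, eq_openOfIndex K U (hHK ▸ hn) hUopen (hUidx.trans hHK)]

/-- **Finite-index subgroups of `Ẑ` are characteristic**: every group automorphism of `Ẑ` (continuous or not)
maps a subgroup of nonzero index onto itself. [cite: RibesZalesskii2010, Thm 2.7.1] -/
theorem map_mulEquiv_eq_of_index_ne_zero
    (φ : completion (GrpCat.of (Multiplicative ℤ)) ≃* completion (GrpCat.of (Multiplicative ℤ)))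
    (H : Subgroup (completion (GrpCat.of (Multiplicative ℤ)))) (hn : 0 < H.index) :
    H.map (φ : completion (GrpCat.of (Multiplicative ℤ)) →* completion (GrpCat.of (Multiplicative ℤ))) = H :=
  eq_of_index_eq _ _ (by rw [H.index_map_equiv φ]; exact hn) (H.index_map_equiv φ)

/-- **The same for any group isomorphic to `Ẑ`** (e.g. `(Δ^tp_Y)^ell`, [EtTh] p. 13): every automorphism `ψ` of
`A ≃* Ẑ` maps every subgroup of nonzero index onto itself — in particular the finite-index subgroup
`(Δ^tp_{Y̲̲})^ell ⊆ (Δ^tp_Y)^ell` of the degree-`l` subcovering `Y̲̲ → Y` ([EtTh] p. 41) is stable under the automorphism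
induced by ANY element of `Π^tp_C`. [cite: MochizukiEtTh2009, Def 2.7 p.41] -/
theorem map_mulEquiv_eq_of_mulEquiv_zHat {A : Type*} [Group A]
    (e : A ≃* completion (GrpCat.of (Multiplicative ℤ))) (ψ : A ≃* A) (H : Subgroup A) (hn : 0 < H.index) :
    H.map (ψ : A →* A) = H := by
  -- transport `H` to a subgroup of `Ẑ` and `ψ` to an automorphism of `Ẑ`
  have hidx := Subgroup.index_map_equiv H e
  have hn' : 0 < (H.map (e : A →* completion (GrpCat.of (Multiplicative ℤ)))).index := hidx.symm ▸ hn
  have key := map_mulEquiv_eq_of_index_ne_zero (e.symm.trans (ψ.trans e)) _ hn'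
  rw [Subgroup.map_map] at key
  -- pull back along the injective `e`
  apply Subgroup.map_injective (f := (e : A →* completion (GrpCat.of (Multiplicative ℤ)))) e.injective
  rw [Subgroup.map_map, ← key]
  congr 1
  ext x
  simp

end ZHatLevels

end Literature.AnabelianGeometry.EtaleTheta

end
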